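import Summits.ValiantsHypothesis.ValiantsHypothesis.Theorems.FeketeSOSFeketeSOSHardPaleyRIPDirectSumBlocks

/-!
# Route FeketeSOS — crux `FeketeSOSHard` (stmt-ValiantsHypothesis-3996), line `paley-rip` v3,
# `stub_tameOperator` on direct sumsets, piece 4: `Σ_j ‖C_j‖_F ≤ ‖pattern‖₂` (Parseval and the block count)

Continuation of `…PaleyRIPDirectSumBlocks.lean` (notation there: `S = D + [0,k)` direct, `N = 2k − 1`, rows
`ρ_d(w_i)`, blocks `G_{dd'} = Σ_i c_i ρ_d(w_i) ρ_{d'}(w_i)`, frequency slices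
`C_j = ((1/N) G_{dd'}(ζ^j))_{d,d'∈D}`).  Steps (3) of `Cruxes/FeketeSOSHard/TameOperatorDplusH.md` §Proof:

* `sum_sqrt_le_sqrt_card_mul` — Cauchy–Schwarz `Σ_{j∈I} √F_j ≤ √(#I · Σ_j F_j)`;
* `frobenius_sq_eq` / `sum_frobenius_sq_eq` — `‖C_j‖_F² = N⁻² Σ_{d,d'} |G_{dd'}(ζ^j)|²` and, by
  `parseval_rootsOfUnity`, `N · Σ_{j<N} ‖C_j‖_F² = Σ_{d,d'} ‖G_{dd'}‖₂²`;
* `coeff_pattern_eq_fiber_sum` — `y_n = Σ_{d+d'+f = n} G_{dd'}(f)` for the pattern `y = Σ_i c_i w_i²`;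
* `blocks_l2_le_pattern_l2` — under the SIDON-TYPE SPACING of `D` relative to `[0, 2k−1)` (all `d + d' + f`
  distinct up to the swap `d ↔ d'`), every fibre `{(d,d',f) : d+d'+f = n}` has `≤ 2` elements carrying the same
  value `g` (`G_{dd'} = G_{d'd}`), so `y_n = m·g`, `Σ_fibre |G|² = m|g|² ≤ m²|g|² = |y_n|²`, whence
  `Σ_{d,d'} ‖G_{dd'}‖₂² ≤ ‖y‖₂² = Σ_{n ∈ supp y} |y_n|²`;
* `frobenius_sum_le_l2` — together: `Σ_{j<N} ‖C_j‖_F ≤ ‖y‖₂`.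

Honest framing (rung currency): Theorems-side helper `--supports` stmt-3996; nothing here closes a registered
stub; `stub_tameOperator`, `stub_paleyFlatRIP` and the crux stay OPEN; `VP ≠ VNP` is untouched.
-/

set_option linter.dupNamespace false

namespace Summit.ValiantsHypothesis.ValiantsHypothesis.Theorems.FeketeSOSHardPaleyRIP

open Polynomial Finset
open scoped BigOperators

noncomputable section

/-! ## Cauchy–Schwarz and Parseval for the frequency slices -/

/-- `Σ_{j∈I} √F_j ≤ √(#I · Σ_{j∈I} F_j)` for nonnegative `F`. [folklore] -/
theorem sum_sqrt_le_sqrt_card_mul {ι : Type*} (I : Finset ι) (F : ι → ℝ) (hF : ∀ j ∈ I, 0 ≤ F j) :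
    ∑ j ∈ I, Real.sqrt (F j) ≤ Real.sqrt ((I.card : ℝ) * ∑ j ∈ I, F j) := by
  have hcs := Finset.sum_mul_sq_le_sq_mul_sq I (fun j => Real.sqrt (F j)) (fun _ => (1 : ℝ))
  simp only [mul_one, one_pow, Finset.sum_const, nsmul_eq_mul, mul_one] at hcs
  have hsq : ∑ j ∈ I, Real.sqrt (F j) ^ 2 = ∑ j ∈ I, F j :=
    Finset.sum_congr rfl fun j hj => Real.sq_sqrt (hF j hj)
  rw [hsq] at hcs
  have h0 : 0 ≤ ∑ j ∈ I, Real.sqrt (F j) := Finset.sum_nonneg fun j _ => Real.sqrt_nonneg _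
  rw [← Real.sqrt_sq h0]
  exact Real.sqrt_le_sqrt (by linarith)

/-- The Frobenius square of a frequency slice: `Σ_{d,d'} |Σ_i (c_i/N) ρ_d(w_i)(x) ρ_{d'}(w_i)(x)|² =
N⁻² Σ_{d,d'} |G_{dd'}(x)|²`. [folklore] -/
theorem frobenius_sq_eq (D : Finset ℕ) (N : ℕ) (r : ℕ) (c : Fin r → ℂ) (ρ : Fin r → ℕ → ℂ[X]) (x : ℂ) :
    (∑ d ∈ D, ∑ d' ∈ D, ‖∑ i, c i / (N : ℂ) * ((ρ i d).eval x * (ρ i d').eval x)‖ ^ 2) =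
      ((N : ℝ) ^ 2)⁻¹ * ∑ d ∈ D, ∑ d' ∈ D, ‖(∑ i, C (c i) * (ρ i d * ρ i d')).eval x‖ ^ 2 := by
  rw [Finset.mul_sum]
  refine Finset.sum_congr rfl fun d _ => ?_
  rw [Finset.mul_sum]
  refine Finset.sum_congr rfl fun d' _ => ?_
  rw [eval_block]
  have : ∑ i, c i / (N : ℂ) * ((ρ i d).eval x * (ρ i d').eval x) =
      (N : ℂ)⁻¹ * ∑ i, c i * ((ρ i d).eval x * (ρ i d').eval x) := by
    rw [Finset.mul_sum]
    exact Finset.sum_congr rfl fun i _ => by ring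
  rw [this, norm_mul, norm_inv, Complex.norm_natCast, mul_pow, inv_pow]

/-- **Parseval for the slices**: `N · Σ_{j<N} ‖C_j‖_F² = Σ_{d,d'} Σ_{n<N} |G_{dd'}(n)|²` (`N = 2k − 1`).
[folklore] -/
theorem sum_frobenius_sq_eq (D : Finset ℕ) (k : ℕ) (hk : 1 ≤ k) (r : ℕ) (c : Fin r → ℂ) (w : Fin r → ℂ[X])
    (ρ : Fin r → ℕ → ℂ[X]) (hρ : ∀ i d, ρ i d = ∑ h ∈ range k, C ((w i).coeff (d + h)) * (X : ℂ[X]) ^ h)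
    (ζ : ℂ) (hζ : IsPrimitiveRoot ζ (2 * k - 1)) :
    ((2 * k - 1 : ℕ) : ℝ) * ∑ j ∈ range (2 * k - 1), (∑ d ∈ D, ∑ d' ∈ D,
        ‖∑ i, c i / ((2 * k - 1 : ℕ) : ℂ) * ((ρ i d).eval (ζ ^ j) * (ρ i d').eval (ζ ^ j))‖ ^ 2) =
      ∑ d ∈ D, ∑ d' ∈ D, ∑ n ∈ range (2 * k - 1), ‖(∑ i, C (c i) * (ρ i d * ρ i d')).coeff n‖ ^ 2 := by
  have hN : 0 < 2 * k - 1 := by omega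
  have hNr : ((2 * k - 1 : ℕ) : ℝ) ≠ 0 := by positivity
  simp_rw [frobenius_sq_eq]
  rw [← Finset.mul_sum, Finset.sum_comm]
  simp_rw [Finset.sum_comm (s := range (2 * k - 1)) (t := D)]
  rw [← mul_assoc, Finset.mul_sum]
  refine Finset.sum_congr rfl fun d _ => ?_
  rw [Finset.mul_sum]
  refine Finset.sum_congr rfl fun d' _ => ?_
  rw [parseval_rootsOfUnity (2 * k - 1) hN ζ hζ _ (natDegree_block_lt k hk r c w d d' ρ hρ)]
  field_simp

/-! ## Coefficients of the pattern as fibre sums -/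

/-- `Σ_{f<N} 𝟙[e + f = n] P_f = [X^n](X^e P)` for `deg P < N`. [folklore] -/
theorem sum_ite_coeff_eq_coeff_X_pow_mul (N e n : ℕ) (P : ℂ[X]) (hP : P.natDegree < N) :
    (∑ f ∈ range N, if e + f = n then P.coeff f else 0) = (X ^ e * P).coeff n := by
  rw [coeff_X_pow_mul']
  by_cases he : e ≤ n
  · rw [if_pos he, Finset.sum_eq_single (n - e)]
    · rw [if_pos (by omega)]
    · intro f _ hf; rw [if_neg (by omega)]
    · intro hf
      rw [mem_range, not_lt] at hf
      rw [if_pos (by omega)]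
      exact coeff_eq_zero_of_natDegree_lt (by omega)
  · rw [if_neg he]
    exact Finset.sum_eq_zero fun f _ => if_neg (by omega)

/-- **Coefficients of the pattern are fibre sums of block coefficients**: with `y = Σ_i c_i w_i²` and
`T = D × D × [0, 2k−1)`, `y_n = Σ_{(d,d',f) ∈ T, d+d'+f = n} G_{dd'}(f)`. [folklore] -/
theorem coeff_pattern_eq_fiber_sum (D : Finset ℕ) (k : ℕ) (hk : 1 ≤ k)
    (hdirect : ∀ d ∈ D, ∀ h < k, ∀ d' ∈ D, ∀ h' < k, d + h = d' + h' → d = d')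
    (r : ℕ) (c : Fin r → ℂ) (w : Fin r → ℂ[X])
    (hw : ∀ i, (w i).support ⊆ (D ×ˢ range k).image (fun x => x.1 + x.2))
    (ρ : Fin r → ℕ → ℂ[X]) (hρ : ∀ i d, ρ i d = ∑ h ∈ range k, C ((w i).coeff (d + h)) * (X : ℂ[X]) ^ h)
    (n : ℕ) :
    (∑ i, C (c i) * w i ^ 2).coeff n =
      ∑ t ∈ ((D ×ˢ D) ×ˢ range (2 * k - 1)).filter (fun t => t.1.1 + t.1.2 + t.2 = n),
        (∑ i, C (c i) * (ρ i t.1.1 * ρ i t.1.2)).coeff t.2 := by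
  rw [pattern_blocks D k hdirect r c w hw ρ hρ, finsetSum_coeff, Finset.sum_filter, Finset.sum_product,
    Finset.sum_product]
  refine Finset.sum_congr rfl fun d _ => ?_
  rw [finsetSum_coeff]
  refine Finset.sum_congr rfl fun d' _ => ?_
  exact (sum_ite_coeff_eq_coeff_X_pow_mul _ _ _ _ (natDegree_block_lt k hk r c w d d' ρ hρ)).symm

/-- `Σ_{n∈A} |y_n|² ≤ ‖y‖₂² = Σ_{n ∈ supp y} |y_n|²` for any finite `A`. [folklore] -/
theorem sum_norm_coeff_sq_le_support (y : ℂ[X]) (A : Finset ℕ) :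
    ∑ n ∈ A, ‖y.coeff n‖ ^ 2 ≤ ∑ n ∈ y.support, ‖y.coeff n‖ ^ 2 := by
  classical
  calc ∑ n ∈ A, ‖y.coeff n‖ ^ 2 = ∑ n ∈ A with n ∈ y.support, ‖y.coeff n‖ ^ 2 := by
        refine (Finset.sum_filter_of_ne fun n _ hne => mem_support_iff.2 fun h0 => hne ?_).symm
        rw [h0, norm_zero, zero_pow two_ne_zero]
    _ ≤ ∑ n ∈ y.support, ‖y.coeff n‖ ^ 2 :=
        Finset.sum_le_sum_of_subset_of_nonneg (fun n hn => (Finset.mem_filter.1 hn).2)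
          fun _ _ _ => sq_nonneg _

/-! ## The block count under the Sidon-type spacing -/

/-- **`Σ_{d,d'∈D} ‖G_{dd'}‖₂² ≤ ‖y‖₂²`** when all `d + d' + f` (`{d,d'} ⊆ D`, `f < 2k − 1`) are distinct up to
the swap `d ↔ d'`. [folklore] -/
theorem blocks_l2_le_pattern_l2 (D : Finset ℕ) (k : ℕ) (hk : 1 ≤ k)
    (hD : ∀ d₁ ∈ D, ∀ d₁' ∈ D, ∀ d₂ ∈ D, ∀ d₂' ∈ D, ∀ f₁ < 2 * k - 1, ∀ f₂ < 2 * k - 1,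
      d₁ + d₁' + f₁ = d₂ + d₂' + f₂ → (d₁ = d₂ ∧ d₁' = d₂') ∨ (d₁ = d₂' ∧ d₁' = d₂))
    (r : ℕ) (c : Fin r → ℂ) (w : Fin r → ℂ[X])
    (hw : ∀ i, (w i).support ⊆ (D ×ˢ range k).image (fun x => x.1 + x.2))
    (ρ : Fin r → ℕ → ℂ[X]) (hρ : ∀ i d, ρ i d = ∑ h ∈ range k, C ((w i).coeff (d + h)) * (X : ℂ[X]) ^ h) :
    (∑ d ∈ D, ∑ d' ∈ D, ∑ n ∈ range (2 * k - 1), ‖(∑ i, C (c i) * (ρ i d * ρ i d')).coeff n‖ ^ 2) ≤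
      ∑ n ∈ (∑ i, C (c i) * w i ^ 2).support, ‖(∑ i, C (c i) * w i ^ 2).coeff n‖ ^ 2 := by
  classical
  have hdirect := direct_of_sidon D k hD
  set y : ℂ[X] := ∑ i, C (c i) * w i ^ 2 with hy
  set T : Finset ((ℕ × ℕ) × ℕ) := (D ×ˢ D) ×ˢ range (2 * k - 1) with hT
  set φ : (ℕ × ℕ) × ℕ → ℕ := fun t => t.1.1 + t.1.2 + t.2 with hφ
  set val : (ℕ × ℕ) × ℕ → ℂ := fun t => (∑ i, C (c i) * (ρ i t.1.1 * ρ i t.1.2)).coeff t.2 with hval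
  -- symmetry of the blocks
  have hsymm : ∀ d d', (∑ i, C (c i) * (ρ i d * ρ i d')) = ∑ i, C (c i) * (ρ i d' * ρ i d) :=
    fun d d' => Finset.sum_congr rfl fun i _ => by rw [mul_comm (ρ i d)]
  -- the fibre bound
  have hfib : ∀ n, (∑ t ∈ T with φ t = n, ‖val t‖ ^ 2) ≤ ‖y.coeff n‖ ^ 2 := by
    intro n
    have hcoeff : y.coeff n = ∑ t ∈ T with φ t = n, val t :=
      coeff_pattern_eq_fiber_sum D k hk hdirect r c w hw ρ hρ n
    by_cases hne : (T.filter fun t => φ t = n).Nonempty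
    · obtain ⟨t₀, ht₀⟩ := hne
      -- all values on the fibre agree with `val t₀`
      have hconst : ∀ t ∈ T.filter (fun t => φ t = n), val t = val t₀ := by
        intro t ht
        rw [Finset.mem_filter, hT, Finset.mem_product, Finset.mem_product, mem_range] at ht ht₀
        have h := hD t.1.1 ht.1.1.1 t.1.2 ht.1.1.2 t₀.1.1 ht₀.1.1.1 t₀.1.2 ht₀.1.1.2 t.2 ht.1.2 t₀.2 ht₀.1.2
          (by simp only [hφ] at ht ht₀; omega)
        have hf : t.2 = t₀.2 := by
          simp only [hφ] at ht ht₀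
          rcases h with ⟨h1, h2⟩ | ⟨h1, h2⟩ <;> omega
        simp only [hval]
        rcases h with ⟨h1, h2⟩ | ⟨h1, h2⟩
        · rw [h1, h2, hf]
        · rw [h1, h2, hf, hsymm]
      set m : ℕ := (T.filter fun t => φ t = n).card with hm
      have hm1 : 1 ≤ m := Finset.card_pos.2 ⟨t₀, ht₀⟩
      have hsumval : y.coeff n = (m : ℂ) * val t₀ := by
        rw [hcoeff, Finset.sum_congr rfl hconst, Finset.sum_const, nsmul_eq_mul]
      have hsumsq : (∑ t ∈ T with φ t = n, ‖val t‖ ^ 2) = (m : ℝ) * ‖val t₀‖ ^ 2 := by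
        rw [Finset.sum_congr rfl fun t ht => by rw [hconst t ht], Finset.sum_const, nsmul_eq_mul]
      rw [hsumsq, hsumval, norm_mul, Complex.norm_natCast, mul_pow]
      have hm1' : (1 : ℝ) ≤ m := by exact_mod_cast hm1
      have hmm : (m : ℝ) ≤ (m : ℝ) ^ 2 := by nlinarith [hm1']
      exact mul_le_mul_of_nonneg_right hmm (sq_nonneg _)
    · rw [Finset.not_nonempty_iff_eq_empty] at hne
      rw [hne, Finset.sum_empty]
      positivity
  -- assemble
  calc (∑ d ∈ D, ∑ d' ∈ D, ∑ n ∈ range (2 * k - 1), ‖(∑ i, C (c i) * (ρ i d * ρ i d')).coeff n‖ ^ 2)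
      = ∑ t ∈ T, ‖val t‖ ^ 2 := by
        rw [hT, Finset.sum_product, Finset.sum_product]
    _ = ∑ n ∈ T.image φ, ∑ t ∈ T with φ t = n, ‖val t‖ ^ 2 :=
        (Finset.sum_fiberwise_of_maps_to (fun t ht => Finset.mem_image_of_mem φ ht) _).symm
    _ ≤ ∑ n ∈ T.image φ, ‖y.coeff n‖ ^ 2 := Finset.sum_le_sum fun n _ => hfib n
    _ ≤ ∑ n ∈ y.support, ‖y.coeff n‖ ^ 2 := sum_norm_coeff_sq_le_support y _

/-- **`Σ_{j<N} ‖C_j‖_F ≤ ‖y‖₂`.**  For `k ≥ 1`, `D` with the Sidon-type spacing relative to `[0, 2k−1)`,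
weighted squares `(c_i, w_i)_{i<r}` supported in `D + [0,k)` with pattern `y = Σ_i c_i w_i²`, and `ζ` a
primitive `(2k−1)`-th root of unity:
`Σ_{j<2k−1} (Σ_{d,d'} |Σ_i (c_i/(2k−1)) ρ_d(w_i)(ζ^j) ρ_{d'}(w_i)(ζ^j)|²)^{1/2} ≤ (Σ_{n∈supp y} |y_n|²)^{1/2}`.
[folklore] -/
theorem frobenius_sum_le_l2 (D : Finset ℕ) (k : ℕ) (hk : 1 ≤ k)
    (hD : ∀ d₁ ∈ D, ∀ d₁' ∈ D, ∀ d₂ ∈ D, ∀ d₂' ∈ D, ∀ f₁ < 2 * k - 1, ∀ f₂ < 2 * k - 1,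
      d₁ + d₁' + f₁ = d₂ + d₂' + f₂ → (d₁ = d₂ ∧ d₁' = d₂') ∨ (d₁ = d₂' ∧ d₁' = d₂))
    (r : ℕ) (c : Fin r → ℂ) (w : Fin r → ℂ[X])
    (hw : ∀ i, (w i).support ⊆ (D ×ˢ range k).image (fun x => x.1 + x.2))
    (ρ : Fin r → ℕ → ℂ[X]) (hρ : ∀ i d, ρ i d = ∑ h ∈ range k, C ((w i).coeff (d + h)) * (X : ℂ[X]) ^ h)
    (ζ : ℂ) (hζ : IsPrimitiveRoot ζ (2 * k - 1)) :
    ∑ j ∈ range (2 * k - 1), Real.sqrt (∑ d ∈ D, ∑ d' ∈ D,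
        ‖∑ i, c i / ((2 * k - 1 : ℕ) : ℂ) * ((ρ i d).eval (ζ ^ j) * (ρ i d').eval (ζ ^ j))‖ ^ 2) ≤
      Real.sqrt (∑ n ∈ (∑ i, C (c i) * w i ^ 2).support, ‖(∑ i, C (c i) * w i ^ 2).coeff n‖ ^ 2) := by
  refine (sum_sqrt_le_sqrt_card_mul _ _ fun j _ =>
    Finset.sum_nonneg fun _ _ => Finset.sum_nonneg fun _ _ => sq_nonneg _).trans ?_
  rw [Finset.card_range, sum_frobenius_sq_eq D k hk r c w ρ hρ ζ hζ]
  exact Real.sqrt_le_sqrt (blocks_l2_le_pattern_l2 D k hk hD r c w hw ρ hρ)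

end

end Summit.ValiantsHypothesis.ValiantsHypothesis.Theorems.FeketeSOSHardPaleyRIP
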